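import Literature.Probability.Percolation.LandedAltPivotalBoundary
import Literature.Probability.Percolation.OneArmPivotalSumGen
import HarnessLib

/-!
# The pivotal sum of the landed alternating four-arm event (Werner's Lemma 6.3: `|d/dp π̂| ≤ c π̂ · d/dp h`, proofs only)

Topic `Literature/Probability/Percolation`; family `crit-perc`. PROOFS ONLY (no definition, no
named fact). The summation step of the discharge of
`Literature.Probability.Percolation.Werner2009_lemma63` through Werner's alternating `π̂`
(W. Werner, *Lectures on two-dimensional critical percolation*, PCMI 2009, Lecture 6, §5, "Using
differential inequalities for the four arm event": "`|d/dp π̂_p(n)| ≤ Σ_x P_p(x is pivotal for Π̂_n)`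
… cut-and-pasting arguments … `≤ c Σ_x π̂_p(‖x‖/2)² π̂_p(2‖x‖, n) ≤ c' Σ_x π̂_p(‖x‖/2) π̂_p(n) ≤
c'' π̂_p(n) × d/dp h_p(n)`"), for the LANDED alternating event `landedAltFourArm r₀ N`
(`LandedAltFourArm.lean`): at a fixed parameter `t` and radius `N`, from

* the kernel inputs for `q(r, R) = π̂^alt_t(r, R) = altFourArmProbAt t r R` — quasi-multiplicativity at
  the inner radius `r₀` (`hQ`, Werner's Cor. 6.2, `AltFourArmGlue.lean`) and the a priori lower bound
  (`hL`, §3, third estimate);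
* the host inputs for `P = P_t(landedAltFourArm r₀ N)` — gluing `c_H π̂^alt(r₀, m) π̂^alt(m', N) ≤ P`
  (`hHost`) and extension `c_E π̂^alt(r₀, M) ≤ P` (`hHostExt`) (Kesten's gluing lands in the landed
  event, `sepFour_mul_sepFour_mul_glue_le_landed_at`);
* the half-plane two-arm bound `P_t(B_{T,F}(m, n)) ≤ C_H m/n` (`hHP`, `Werner2009_halfPlane_twoArm_holds`),

this file proves (`landedPivotalSum_le`)

  `Σ_{v : r₀ ≤ |v| ≤ N} P_t(v pivotal for landedAltFourArm r₀ N) ≤ K · (N² π̂^alt_t(r₀, N)) · P_t(landedAltFourArm r₀ N)`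

with an explicit `K`. Per-site regimes (`|v|_𝕋 = k`): small `k` (outer arms only,
`isPivotal_landedAlt_subset_outer`); the bulk `k ≤ (N - 1024)/14` (the three annuli,
`measureReal_isPivotal_landedAlt_le`, host gluing, the kernel ratio bound `kernel_le_ratio_mul`,
shells summed by `sum_shell_weight_le`); the middle range (inner and local annuli only, host
extension); the boundary layer of depth `< N/128` (`boundary_pivotal_three_le_landed` with
`D = N/8`, the half-plane factor `≤ 48 C_H d'/N`, `layer_sum_deep_le`; the `d₀` shallowest shells by
the two-factor bound `boundary_pivotal_two_le_landed` and `layer_sum_shallow_le`).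

## References

* W. Werner, *Lectures on two-dimensional critical percolation*, IAS/Park City Math. Ser. 16
  (2009), Lecture 6, §5 (proof of Lemma 6.3) and proof of Lemma 6.2 (boundary contributions)
  [WernerPCMI2009].
* P. Nolin, Near-critical percolation in two dimensions, *Electron. J. Probab.* 13 (2008), §6.2,
  proof of Thm. 27 (arXiv 0711.4948: Thm. 26), §4.6 [Nolin2008].
* H. Kesten, Scaling relations for 2D-percolation, *Comm. Math. Phys.* 109 (1987), Lemma 8
  [KestenScalingCMP1987].

Tree: `measureReal_isPivotal_landedAlt_le`, `isPivotal_landedAlt_subset_inner/local/outer`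
(`LandedAltPivotalCut.lean`), `boundary_pivotal_three_le_landed`, `isPivotal_landedAlt_subset_dom`
(`LandedAltPivotalBoundary.lean`), `kernel_le_ratio_mul` (`OneArmPivotalSumGen.lean`),
`sum_shell_weight_le`, `card_triSphere_le`, `sum_triBall_eq_sum_triSphere`, `div_rpow_two_sub`
(`OneArmPivotalSum.lean`), `layer_sum_deep_le`, `layer_sum_shallow_le`, `relabel_shift_shift`,
`determinedBy_preimage_shift` (`OneArmPivotalLayer.lean`), `exists_rot_halfPlane_superset`,
`shift_mem_domArmEvent_recenter`, `real_domArmEvent_rotPow` (`OneArmBoundaryArms.lean`),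
`altFourArmProbAt_anti/mono_left/nonneg/le_one`, `determinedBy_altFourArm` (`AltFourArm.lean`),
`determinedBy_preimage_shift_altFourArm` (`CutPointAltArms.lean`).
-/

noncomputable section

open MeasureTheory Set Finset Real
open scoped unitInterval

namespace Literature.Probability.Percolation

open LatticeModels

/-! ### Two-factor bounds (inner × local, inner × half-plane pair) -/

section TwoFactor

variable {r₀ N d m k D d' d₂ m₀ : ℕ} {v : Site 2}

/-- **Inner and local annuli only**: for `1 ≤ r₀ ≤ m`, `1 ≤ d`, `|v|_𝕋 = k`, `r₀ + 2d ≤ k`,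
`m + d + 1 ≤ k`, `k + d ≤ N`: `P_t(v pivotal) ≤ π̂^alt_t(r₀, m) · π̂^alt_t(1, d)` (independence of
`Λ_m ∖ Λ_{r₀}` and `v + (Λ_d ∖ Λ_0)`). [cite: WernerPCMI2009, Lecture 6, §5 (the three annuli; the outer one dropped)] -/
theorem measureReal_isPivotal_landedAlt_le₂ (t : unitInterval) (hr₀ : 1 ≤ r₀) (hd : 1 ≤ d)
    (hk : triNorm v = k) (hkr : r₀ + 2 * d ≤ k) (hkN : k + d ≤ N) (hr₀m : r₀ ≤ m) (hm : m + d + 1 ≤ k) :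
    (triSitePercolation t).real {ω | IsPivotal (landedAltFourArm r₀ N) v ω} ≤
      altFourArmProbAt t r₀ m * altFourArmProbAt t 1 d := by
  classical
  set e := (triShiftIso (-v)).toEquiv with he
  set A : Set (SiteConfig (Site 2)) := altFourArm r₀ m with hA
  set B : Set (SiteConfig (Site 2)) := SiteConfig.relabel e ⁻¹' altFourArm 1 d with hB
  set F : Finset (Site 2) := triAnnulus r₀ m with hF
  set G : Finset (Site 2) := (triAnnulus 1 d).image fun u => u + v with hG
  have hAF : DeterminedBy A ↑F := determinedBy_altFourArm hr₀m
  have hBG : DeterminedBy B ↑G := determinedBy_preimage_shift_altFourArm hd v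
  have hGmem : ∀ z ∈ G, triNorm v - d ≤ triNorm z := by
    intro z hz
    have hz' : z ∈ (fun u => u + v) '' (↑(triAnnulus 1 d) : Set (Site 2)) := by
      rw [← Finset.coe_image]; exact Finset.mem_coe.2 hz
    exact le_triNorm_of_mem_shift_annulus hz'
  have hFG : Disjoint F G := by
    rw [Finset.disjoint_left]
    intro z hzF hzG
    rw [hF, mem_triAnnulus] at hzF
    have := hGmem z hzG
    omega
  have h1 : (triSitePercolation t).real (A ∩ B) =
      (triSitePercolation t).real A * (triSitePercolation t).real B :=
    sitePercolation_real_inter_of_disjoint t hAF hBG hFG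
  have h3 : (triSitePercolation t).real B = altFourArmProbAt t 1 d := by
    rw [altFourArmProbAt, hB, triSitePercolation]
    exact sitePercolation_real_preimage_relabel e t _
  have hsub : {ω : SiteConfig (Site 2) | IsPivotal (landedAltFourArm r₀ N) v ω} ⊆ A ∩ B :=
    subset_inter (isPivotal_landedAlt_subset_inner hr₀ hk hr₀m (by omega) (by omega))
      (isPivotal_landedAlt_subset_local hr₀ hd hk hkr hkN)
  calc (triSitePercolation t).real {ω | IsPivotal (landedAltFourArm r₀ N) v ω}
      ≤ (triSitePercolation t).real (A ∩ B) := measureReal_mono hsub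
    _ = altFourArmProbAt t r₀ m * altFourArmProbAt t 1 d := by rw [h1, h3]; rfl

/-- **Inner annulus and the mixed half-plane pair, no local factor** (the shallowest shells): for
`|v|_𝕋 = k`, `k + d' = N`, `1 ≤ r₀ ≤ m₀`, `1 ≤ d₂`, `r₀ + 2D ≤ k`, `4D ≤ N`, `m₀ + D + 1 ≤ k`,
`d₂ + 2d' + 1 ≤ D`: `P_t(v pivotal) ≤ P_t(altFourArm r₀ m₀) · P_t(B_{T,F}(d₂ + d', D - d'))`. [cite: WernerPCMI2009, Lecture 6, proof of Lemma 6.2 (boundary contributions)] [cite: Nolin2008, §4.6] -/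
theorem boundary_pivotal_two_le_landed (t : unitInterval) (hr₀ : 1 ≤ r₀) (hk : triNorm v = k)
    (hkN : k + d' = N) (hr₀m : r₀ ≤ m₀) (hd₂ : 1 ≤ d₂) (h2D : r₀ + 2 * D ≤ k) (h4D : 4 * D ≤ N)
    (hm₀ : m₀ + D + 1 ≤ k) (hrec : d₂ + 2 * d' + 1 ≤ D) :
    (triSitePercolation t).real {ω | IsPivotal (landedAltFourArm r₀ N) v ω} ≤
      (triSitePercolation t).real (altFourArm r₀ m₀) *
        (triSitePercolation t).real (domArmEvent ![true, false] (d₂ + d') (D - d') upperHalfPlane) := by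
  classical
  obtain ⟨j, -, tt, htt, hdom⟩ := exists_rot_halfPlane_superset (N := N) hk hkN
  set G : Set (Site 2) := (triRotIsoPow j) '' upperHalfPlane with hG
  set A : Set (SiteConfig (Site 2)) := altFourArm r₀ m₀ with hA
  set C : Set (SiteConfig (Site 2)) :=
    SiteConfig.relabel (triShiftIso (-(v + tt))).toEquiv ⁻¹'
      domArmEvent ![true, false] (d₂ + d') (D - d') G with hC
  have hincl : {ω : SiteConfig (Site 2) | IsPivotal (landedAltFourArm r₀ N) v ω} ⊆ A ∩ C := by
    intro ω hω
    have hω' : IsPivotal (landedAltFourArm r₀ N) v ω := hω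
    refine ⟨isPivotal_landedAlt_subset_inner hr₀ hk hr₀m (by omega) (by omega) hω', ?_⟩
    have h2 := isPivotal_landedAlt_subset_dom (d₂ := d₂) (D := D) hr₀ hd₂ (by omega) hk
      (by omega) h2D h4D hω'
    have h3 := shift_mem_domArmEvent_recenter (κ := ![true, false]) (G := G) htt hrec hdom h2
    rw [relabel_shift_shift] at h3
    exact h3
  set F : Finset (Site 2) := triAnnulus r₀ m₀ with hF
  set G₂ : Finset (Site 2) := (triAnnulus (d₂ + d') (D - d')).image fun u => u + (v + tt) with hG₂
  have hAF : DeterminedBy A ↑F := determinedBy_altFourArm hr₀m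
  have hCG : DeterminedBy C ↑G₂ :=
    determinedBy_preimage_shift (determinedBy_domArmEvent _ (by omega) G) (v + tt)
  have hG₂mem : ∀ z ∈ G₂, (k : ℤ) - D ≤ triNorm z := by
    intro z hz
    rw [hG₂, Finset.mem_image] at hz
    obtain ⟨u, hu, rfl⟩ := hz
    rw [mem_triAnnulus] at hu
    push_cast [Nat.cast_sub (show d' ≤ D by omega)] at hu
    have h1 := triNorm_add_le (u + (v + tt)) (-(u + tt))
    rw [show u + (v + tt) + -(u + tt) = v by abel, triNorm_neg] at h1
    have h2 := triNorm_add_le u tt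
    rw [htt] at h2
    rw [← hk]; omega
  have hFG₂ : Disjoint F G₂ := by
    rw [Finset.disjoint_left]
    intro z hzF hz
    rw [hF, mem_triAnnulus] at hzF
    have := hG₂mem z hz; omega
  have h1 : (triSitePercolation t).real (A ∩ C) =
      (triSitePercolation t).real A * (triSitePercolation t).real C :=
    sitePercolation_real_inter_of_disjoint t hAF hCG hFG₂
  have h4 : (triSitePercolation t).real C =
      (triSitePercolation t).real (domArmEvent ![true, false] (d₂ + d') (D - d') upperHalfPlane) := by
    rw [hC, triSitePercolation, sitePercolation_real_preimage_relabel, hG]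
    exact real_domArmEvent_rotPow t _ _ _ j
  calc (triSitePercolation t).real {ω | IsPivotal (landedAltFourArm r₀ N) v ω}
      ≤ (triSitePercolation t).real (A ∩ C) := measureReal_mono hincl
    _ = _ := by rw [h1, h4]

end TwoFactor

/-! ### The per-site regimes -/

section Regimes

variable {t : unitInterval} {N r₀ rL rH n₀ : ℕ} {cQ cL cH cE CH β : ℝ}

/-- A power `≥` the square on `(0, 1]`: `x^{2-β} ≥ x²` for `0 < x ≤ 1`, `0 ≤ β ≤ 2`. [folklore] -/
theorem sq_le_rpow_two_sub {x β : ℝ} (hx : 0 < x) (hx1 : x ≤ 1) (hβ : 0 ≤ β) :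
    x ^ 2 ≤ x ^ (2 - β) := by
  rw [← Real.rpow_two]
  exact Real.rpow_le_rpow_of_exponent_ge hx hx1 (by linarith)

/-- **`1 ≤ N² π̂^alt(r₀, N) / c_L'`**: from the a priori lower bound, `c_L r₀² / ... `; precisely
`c_L ≤ N² π̂^alt_t(r₀, N)` for `r_L ≤ r₀ ≤ N`, `1 ≤ r₀` (since `(r₀/N)^{2-β} ≥ (r₀/N)² ≥ 1/N²`). [folklore] -/
theorem cL_le_sq_mul_alt (hcL : 0 < cL) (hβ : 0 < β)
    (hL : ∀ m n : ℕ, rL ≤ m → m ≤ n → n ≤ N → cL * ((m : ℝ) / n) ^ (2 - β) ≤ altFourArmProbAt t m n)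
    (hr₀ : 1 ≤ r₀) (hrL : rL ≤ r₀) (hr₀N : r₀ ≤ N) :
    cL ≤ (N : ℝ) ^ 2 * altFourArmProbAt t r₀ N := by
  have hN0 : (0 : ℝ) < N := by exact_mod_cast (show 0 < N by omega)
  have hr0 : (0 : ℝ) < r₀ := by exact_mod_cast (show 0 < r₀ by omega)
  have h := hL r₀ N hrL hr₀N le_rfl
  have hx1 : (r₀ : ℝ) / N ≤ 1 := by rw [div_le_one hN0]; exact_mod_cast hr₀N
  have hx0 : 0 < (r₀ : ℝ) / N := div_pos hr0 hN0
  have h2 : ((1 : ℝ) / N) ^ 2 ≤ ((r₀ : ℝ) / N) ^ (2 - β) := by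
    refine le_trans ?_ (sq_le_rpow_two_sub hx0 hx1 hβ.le)
    apply pow_le_pow_left₀ (by positivity)
    exact div_le_div_of_nonneg_right (by exact_mod_cast hr₀) hN0.le
  calc cL = cL * ((1 : ℝ) / N) ^ 2 * (N : ℝ) ^ 2 := by field_simp
    _ ≤ cL * ((r₀ : ℝ) / N) ^ (2 - β) * (N : ℝ) ^ 2 := by
        apply mul_le_mul_of_nonneg_right _ (by positivity)
        exact mul_le_mul_of_nonneg_left h2 hcL.le
    _ ≤ altFourArmProbAt t r₀ N * (N : ℝ) ^ 2 := mul_le_mul_of_nonneg_right h (by positivity)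
    _ = (N : ℝ) ^ 2 * altFourArmProbAt t r₀ N := by ring

/-- **Small distances** (`r₀ ≤ |v|_𝕋 < K₀`): only the outer arms are kept
(`isPivotal_landedAlt_subset_outer`), `P_t(v pivotal) ≤ π̂^alt(|v|+1, N) ≤ π̂^alt(4K₀, N) ≤
π̂^alt(r₀, N) / (c_Q π̂^alt(r₀, K₀)) ≤ (K₀²/(c_Q c_L r₀²)) π̂^alt(r₀, N)`, and the host extension with the
lower bound supplies the factor `P`: `1 ≤ N² P / (c_E c_L)` … precisely
`P_t(v pivotal) ≤ (K₀² / (c_Q c_L² c_E r₀²)) · N² π̂^alt_t(r₀, N) · P_t(landedAltFourArm r₀ N)`. [cite: WernerPCMI2009, Lecture 6, §5 (contributions of the sites close to the inner hexagon)] -/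
theorem landed_pivotal_small (hcQ : 0 < cQ) (hcL : 0 < cL) (hcE : 0 < cE) (hβ : 0 < β)
    (hQ : ∀ R S : ℕ, 16 * r₀ < 4 * R → 4 * R < S → S ≤ N →
      cQ * (altFourArmProbAt t r₀ R * altFourArmProbAt t (4 * R) S) ≤ altFourArmProbAt t r₀ S)
    (hL : ∀ m n : ℕ, rL ≤ m → m ≤ n → n ≤ N → cL * ((m : ℝ) / n) ^ (2 - β) ≤ altFourArmProbAt t m n)
    (hExt : ∀ M : ℕ, N / 64 ≤ M → M ≤ N / 16 - 64 →
      cE * altFourArmProbAt t r₀ M ≤ (triSitePercolation t).real (landedAltFourArm r₀ N))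
    {K₀ : ℕ} (hr₀ : 1 ≤ r₀) (hrL : rL ≤ r₀) (hK₀ : 4 * r₀ + 1 ≤ K₀) (hN : 64 * K₀ + 6000 ≤ N)
    {v : Site 2} {k : ℕ} (hk : triNorm v = k) (hr₀k : r₀ ≤ k) (hkK : k < K₀) :
    (triSitePercolation t).real {ω | IsPivotal (landedAltFourArm r₀ N) v ω} ≤
      (K₀ : ℝ) ^ 2 / (cQ * cL ^ 2 * cE * (r₀ : ℝ) ^ 2) *
        (((N : ℝ) ^ 2 * altFourArmProbAt t r₀ N) * (triSitePercolation t).real (landedAltFourArm r₀ N)) := by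
  set P : ℝ := (triSitePercolation t).real (landedAltFourArm r₀ N) with hP
  have hr0 : (0 : ℝ) < r₀ := by exact_mod_cast (show 0 < r₀ by omega)
  have hK0 : (0 : ℝ) < K₀ := by exact_mod_cast (show 0 < K₀ by omega)
  have hN0 : (0 : ℝ) < N := by exact_mod_cast (show 0 < N by omega)
  -- outer arms: `P_t(v pivotal) ≤ π̂^alt(4K₀, N)`
  have h1 : (triSitePercolation t).real {ω | IsPivotal (landedAltFourArm r₀ N) v ω} ≤
      altFourArmProbAt t (4 * K₀) N := by
    refine (measureReal_mono (isPivotal_landedAlt_subset_outer (m' := k + 1) hr₀ hk hr₀k le_rfl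
      (by omega)) (measure_ne_top _ _)).trans ?_
    exact altFourArmProbAt_mono_left t (by omega) (by omega)
  -- quasi-multiplicativity: `π̂(4K₀, N) ≤ π̂(r₀, N) / (c_Q π̂(r₀, K₀))`, `π̂(r₀, K₀) ≥ c_L (r₀/K₀)²`
  have h2 := hQ K₀ N (by omega) (by omega) le_rfl
  have h3 := hL r₀ K₀ hrL (by omega) (by omega)
  have hx0 : 0 < (r₀ : ℝ) / K₀ := div_pos hr0 hK0
  have hx1 : (r₀ : ℝ) / K₀ ≤ 1 := by rw [div_le_one hK0]; exact_mod_cast (show r₀ ≤ K₀ by omega)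
  have h3' : cL * ((r₀ : ℝ) / K₀) ^ 2 ≤ altFourArmProbAt t r₀ K₀ :=
    (mul_le_mul_of_nonneg_left (sq_le_rpow_two_sub hx0 hx1 hβ.le) hcL.le).trans h3
  have hqK0 : 0 < altFourArmProbAt t r₀ K₀ := lt_of_lt_of_le (by positivity) h3'
  have h4 : altFourArmProbAt t (4 * K₀) N ≤
      (K₀ : ℝ) ^ 2 / (cQ * cL * (r₀ : ℝ) ^ 2) * altFourArmProbAt t r₀ N := by
    -- from `c_Q q(r₀,K₀) q(4K₀,N) ≤ q(r₀,N)` and `q(r₀,K₀) ≥ c_L r₀²/K₀²`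
    have hden : 0 < cQ * altFourArmProbAt t r₀ K₀ := mul_pos hcQ hqK0
    have h5 : altFourArmProbAt t (4 * K₀) N ≤ altFourArmProbAt t r₀ N / (cQ * altFourArmProbAt t r₀ K₀) := by
      rw [le_div_iff₀ hden]
      calc altFourArmProbAt t (4 * K₀) N * (cQ * altFourArmProbAt t r₀ K₀)
          = cQ * (altFourArmProbAt t r₀ K₀ * altFourArmProbAt t (4 * K₀) N) := by ring
        _ ≤ altFourArmProbAt t r₀ N := h2
    refine h5.trans ?_
    rw [div_le_iff₀ hden]
    have hq0 : 0 ≤ altFourArmProbAt t r₀ N := altFourArmProbAt_nonneg t r₀ N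
    have : altFourArmProbAt t r₀ N * (cQ * cL * (r₀ : ℝ) ^ 2 / (K₀ : ℝ) ^ 2) ≤
        altFourArmProbAt t r₀ N * (cQ * altFourArmProbAt t r₀ K₀) := by
      apply mul_le_mul_of_nonneg_left _ hq0
      have : cL * (r₀ : ℝ) ^ 2 / (K₀ : ℝ) ^ 2 ≤ altFourArmProbAt t r₀ K₀ := by
        rw [div_pow] at h3'; rwa [mul_div_assoc]
      calc cQ * cL * (r₀ : ℝ) ^ 2 / (K₀ : ℝ) ^ 2 = cQ * (cL * (r₀ : ℝ) ^ 2 / (K₀ : ℝ) ^ 2) := by ring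
        _ ≤ cQ * altFourArmProbAt t r₀ K₀ := mul_le_mul_of_nonneg_left this hcQ.le
    calc altFourArmProbAt t r₀ N
        = (K₀ : ℝ) ^ 2 / (cQ * cL * (r₀ : ℝ) ^ 2) * (altFourArmProbAt t r₀ N *
            (cQ * cL * (r₀ : ℝ) ^ 2 / (K₀ : ℝ) ^ 2)) := by field_simp
      _ ≤ (K₀ : ℝ) ^ 2 / (cQ * cL * (r₀ : ℝ) ^ 2) * (altFourArmProbAt t r₀ N *
            (cQ * altFourArmProbAt t r₀ K₀)) := mul_le_mul_of_nonneg_left this (by positivity)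
      _ = (K₀ : ℝ) ^ 2 / (cQ * cL * (r₀ : ℝ) ^ 2) * altFourArmProbAt t r₀ N *
            (cQ * altFourArmProbAt t r₀ K₀) := by ring
  -- the factor `P`: `1 ≤ N² P / (c_E c_L)`
  have hM1 : N / 64 ≤ N / 16 - 64 := by omega
  have h6 := hExt (N / 16 - 64) hM1 le_rfl
  have h7 : altFourArmProbAt t r₀ N ≤ altFourArmProbAt t r₀ (N / 16 - 64) :=
    altFourArmProbAt_anti t r₀ (by omega) (by omega)
  have h8 := cL_le_sq_mul_alt hcL hβ hL hr₀ hrL (by omega)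
  -- `c_L ≤ N² q(r₀,N) ≤ N² q(r₀, N/16-64) ≤ N² P / c_E`
  have h9 : cL * cE ≤ (N : ℝ) ^ 2 * P := by
    calc cL * cE ≤ ((N : ℝ) ^ 2 * altFourArmProbAt t r₀ N) * cE := mul_le_mul_of_nonneg_right h8 hcE.le
      _ ≤ ((N : ℝ) ^ 2 * altFourArmProbAt t r₀ (N / 16 - 64)) * cE := by
          apply mul_le_mul_of_nonneg_right _ hcE.le
          exact mul_le_mul_of_nonneg_left h7 (by positivity)
      _ = (N : ℝ) ^ 2 * (cE * altFourArmProbAt t r₀ (N / 16 - 64)) := by ring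
      _ ≤ (N : ℝ) ^ 2 * P := mul_le_mul_of_nonneg_left h6 (by positivity)
  have h10 : (1 : ℝ) ≤ (N : ℝ) ^ 2 * P / (cL * cE) := by
    rw [le_div_iff₀ (mul_pos hcL hcE), one_mul]; exact h9
  have hq0 : 0 ≤ altFourArmProbAt t r₀ N := altFourArmProbAt_nonneg t r₀ N
  calc (triSitePercolation t).real {ω | IsPivotal (landedAltFourArm r₀ N) v ω}
      ≤ (K₀ : ℝ) ^ 2 / (cQ * cL * (r₀ : ℝ) ^ 2) * altFourArmProbAt t r₀ N := h1.trans h4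
    _ ≤ (K₀ : ℝ) ^ 2 / (cQ * cL * (r₀ : ℝ) ^ 2) * altFourArmProbAt t r₀ N *
          ((N : ℝ) ^ 2 * P / (cL * cE)) := le_mul_of_one_le_right (by positivity) h10
    _ = (K₀ : ℝ) ^ 2 / (cQ * cL ^ 2 * cE * (r₀ : ℝ) ^ 2) *
          (((N : ℝ) ^ 2 * altFourArmProbAt t r₀ N) * P) := by
        field_simp

/-- **The bulk** (`K₀ ≤ |v|_𝕋 = k ≤ (N - 1024)/14`): the three annuli with `d = k/8`,
`m = k - d - 1`, `m' = k + d + 1` (`measureReal_isPivotal_landedAlt_le`), host gluing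
`c_H π̂^alt(r₀, m) π̂^alt(m', N) ≤ P` and the kernel ratio bound
`π̂^alt(1, d) ≤ π̂^alt(r₀, d) ≤ (4/(c_Q c_L)) (N/d)^{2-β} π̂^alt(r₀, N)`:
`P_t(v pivotal) ≤ (324/(c_H c_Q c_L)) (N/k)^{2-β} π̂^alt_t(r₀, N) P`. [cite: WernerPCMI2009, Lecture 6, §5 (c Σ_x π̂_p(‖x‖/2)² π̂_p(2‖x‖,n) ≤ c' Σ_x π̂_p(‖x‖/2) π̂_p(n))] -/
theorem landed_pivotal_inner (hcQ : 0 < cQ) (hcL : 0 < cL) (hcH : 0 < cH) (hβ : 0 < β) (hβ2 : β ≤ 2)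
    (hQ : ∀ R S : ℕ, 16 * r₀ < 4 * R → 4 * R < S → S ≤ N →
      cQ * (altFourArmProbAt t r₀ R * altFourArmProbAt t (4 * R) S) ≤ altFourArmProbAt t r₀ S)
    (hL : ∀ m n : ℕ, rL ≤ m → m ≤ n → n ≤ N → cL * ((m : ℝ) / n) ^ (2 - β) ≤ altFourArmProbAt t m n)
    (hHost : ∀ m m' : ℕ, rH ≤ m → m' ≤ 8 * m → 16 * m + 1024 ≤ N →
      cH * (altFourArmProbAt t r₀ m * altFourArmProbAt t m' N) ≤
        (triSitePercolation t).real (landedAltFourArm r₀ N))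
    (hr₀ : 1 ≤ r₀) (hNr : 20 * r₀ + 10 ≤ N) (hNL : 5 * rL + 5 ≤ N)
    {v : Site 2} {k : ℕ} (hk : triNorm v = k) (hk1 : 64 ≤ k) (hk2 : 8 * (4 * r₀ + 1) ≤ k)
    (hk3 : 8 * rL ≤ k) (hk4 : 2 * rH + 2 ≤ k) (hkN : 14 * k + 1024 ≤ N) :
    (triSitePercolation t).real {ω | IsPivotal (landedAltFourArm r₀ N) v ω} ≤
      324 / (cH * cQ * cL) * ((N : ℝ) / k) ^ (2 - β) *
        (altFourArmProbAt t r₀ N * (triSitePercolation t).real (landedAltFourArm r₀ N)) := by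
  set P : ℝ := (triSitePercolation t).real (landedAltFourArm r₀ N) with hP
  set d : ℕ := k / 8 with hd
  set m : ℕ := k - d - 1 with hm
  set m' : ℕ := k + d + 1 with hm'
  have hk0 : (0 : ℝ) < k := by exact_mod_cast (show 0 < k by omega)
  have hN0 : (0 : ℝ) < N := by exact_mod_cast (show 0 < N by omega)
  have hd0 : (0 : ℝ) < d := by exact_mod_cast (show 0 < d by omega)
  have hexp : (0 : ℝ) ≤ 2 - β := by linarith
  have h1 := measureReal_isPivotal_landedAlt_le t hr₀ (show 1 ≤ d by omega) hk
    (show r₀ + 2 * d ≤ k by omega) (show k + d ≤ N by omega) (show r₀ ≤ m by omega)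
    (show m + d + 1 ≤ k by omega) (show k + d + 1 ≤ m' by omega) (show m' ≤ N by omega)
  have h2 := hHost m m' (by omega) (by omega) (by omega)
  have h3 := kernel_le_ratio_mul (q := fun r R => altFourArmProbAt t r R)
    (fun r R => altFourArmProbAt_nonneg t r R) (fun r R R' h h' => altFourArmProbAt_anti t r h h')
    hcQ hcL hβ hβ2 hQ hL hNr hNL (d := d) (by omega) (by omega) (by omega)
  have h3' : altFourArmProbAt t 1 d ≤ 4 / (cQ * cL) * ((N : ℝ) / d) ^ (2 - β) * altFourArmProbAt t r₀ N :=
    (altFourArmProbAt_mono_left t hr₀ (by omega)).trans h3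
  have h4 : ((N : ℝ) / d) ^ (2 - β) ≤ 81 * ((N : ℝ) / k) ^ (2 - β) := by
    have hle : (N : ℝ) / d ≤ 9 * ((N : ℝ) / k) := by
      rw [div_le_iff₀ hd0, mul_div_assoc', div_mul_eq_mul_div, le_div_iff₀ hk0]
      have hdk : (k : ℝ) ≤ 9 * d := by exact_mod_cast (show k ≤ 9 * d by omega)
      nlinarith
    calc ((N : ℝ) / d) ^ (2 - β) ≤ (9 * ((N : ℝ) / k)) ^ (2 - β) :=
          Real.rpow_le_rpow (by positivity) hle hexp
      _ = (9 : ℝ) ^ (2 - β) * ((N : ℝ) / k) ^ (2 - β) := Real.mul_rpow (by norm_num) (by positivity)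
      _ ≤ (9 : ℝ) ^ (2 : ℝ) * ((N : ℝ) / k) ^ (2 - β) := by
          apply mul_le_mul_of_nonneg_right _ (by positivity)
          exact Real.rpow_le_rpow_of_exponent_le (by norm_num) (by linarith)
      _ = 81 * ((N : ℝ) / k) ^ (2 - β) := by norm_num
  have hqN : 0 ≤ altFourArmProbAt t r₀ N := altFourArmProbAt_nonneg t r₀ N
  have hio : altFourArmProbAt t r₀ m * altFourArmProbAt t m' N ≤ P / cH := by
    rw [le_div_iff₀ hcH, mul_comm]; exact h2
  calc (triSitePercolation t).real {ω | IsPivotal (landedAltFourArm r₀ N) v ω}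
      ≤ altFourArmProbAt t r₀ m * (altFourArmProbAt t 1 d * altFourArmProbAt t m' N) := h1
    _ = altFourArmProbAt t 1 d * (altFourArmProbAt t r₀ m * altFourArmProbAt t m' N) := by ring
    _ ≤ (4 / (cQ * cL) * ((N : ℝ) / d) ^ (2 - β) * altFourArmProbAt t r₀ N) * (P / cH) :=
        mul_le_mul h3' hio (mul_nonneg (altFourArmProbAt_nonneg _ _ _) (altFourArmProbAt_nonneg _ _ _))
          (by positivity)
    _ ≤ (4 / (cQ * cL) * (81 * ((N : ℝ) / k) ^ (2 - β)) * altFourArmProbAt t r₀ N) * (P / cH) := by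
        apply mul_le_mul_of_nonneg_right _ (by positivity)
        apply mul_le_mul_of_nonneg_right _ hqN
        exact mul_le_mul_of_nonneg_left h4 (by positivity)
    _ = 324 / (cH * cQ * cL) * ((N : ℝ) / k) ^ (2 - β) * (altFourArmProbAt t r₀ N * P) := by
        field_simp
        ring

/-- **The middle range** (`(N - 1024)/14 < k ≤ N - N/128`): inner and local annuli only
(`measureReal_isPivotal_landedAlt_le₂` with `d = N/128`), host extension
`π̂^alt(r₀, m) ≤ π̂^alt(r₀, min(m, N/16-64)) ≤ P/c_E` and the kernel ratio bound at `d = N/128`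
(`(N/d)^{2-β} ≤ 129²`): `P_t(v pivotal) ≤ (66564/(c_E c_Q c_L)) π̂^alt_t(r₀, N) P`. [cite: WernerPCMI2009, Lecture 6, §5] -/
theorem landed_pivotal_mid (hcQ : 0 < cQ) (hcL : 0 < cL) (hcE : 0 < cE) (hβ : 0 < β) (hβ2 : β ≤ 2)
    (hQ : ∀ R S : ℕ, 16 * r₀ < 4 * R → 4 * R < S → S ≤ N →
      cQ * (altFourArmProbAt t r₀ R * altFourArmProbAt t (4 * R) S) ≤ altFourArmProbAt t r₀ S)
    (hL : ∀ m n : ℕ, rL ≤ m → m ≤ n → n ≤ N → cL * ((m : ℝ) / n) ^ (2 - β) ≤ altFourArmProbAt t m n)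
    (hExt : ∀ M : ℕ, N / 64 ≤ M → M ≤ N / 16 - 64 →
      cE * altFourArmProbAt t r₀ M ≤ (triSitePercolation t).real (landedAltFourArm r₀ N))
    (hr₀ : 1 ≤ r₀) (hN : 128 * (4 * r₀ + 1) + 128 * rL + 20000 ≤ N)
    {v : Site 2} {k : ℕ} (hk : triNorm v = k) (hk1 : N < 14 * k + 1024) (hk2 : k + N / 128 ≤ N) :
    (triSitePercolation t).real {ω | IsPivotal (landedAltFourArm r₀ N) v ω} ≤
      66564 / (cE * cQ * cL) *
        (altFourArmProbAt t r₀ N * (triSitePercolation t).real (landedAltFourArm r₀ N)) := by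
  set P : ℝ := (triSitePercolation t).real (landedAltFourArm r₀ N) with hP
  set d : ℕ := N / 128 with hd
  set m : ℕ := k - d - 1 with hm
  set M : ℕ := min m (N / 16 - 64) with hM
  have hN0 : (0 : ℝ) < N := by exact_mod_cast (show 0 < N by omega)
  have hd0 : (0 : ℝ) < d := by exact_mod_cast (show 0 < d by omega)
  have hexp : (0 : ℝ) ≤ 2 - β := by linarith
  have h1 := measureReal_isPivotal_landedAlt_le₂ t hr₀ (show 1 ≤ d by omega) hk
    (show r₀ + 2 * d ≤ k by omega) hk2 (show r₀ ≤ m by omega) (show m + d + 1 ≤ k by omega)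
  have hMm : M ≤ m := min_le_left _ _
  have h2 : altFourArmProbAt t r₀ m ≤ altFourArmProbAt t r₀ M := altFourArmProbAt_anti t r₀ (by omega) hMm
  have h3 := hExt M (by omega) (min_le_right _ _)
  have h23 : altFourArmProbAt t r₀ m ≤ P / cE := by
    rw [le_div_iff₀ hcE, mul_comm]
    calc cE * altFourArmProbAt t r₀ m ≤ cE * altFourArmProbAt t r₀ M := mul_le_mul_of_nonneg_left h2 hcE.le
      _ ≤ P := h3
  have h4 := kernel_le_ratio_mul (q := fun r R => altFourArmProbAt t r R)
    (fun r R => altFourArmProbAt_nonneg t r R) (fun r R R' h h' => altFourArmProbAt_anti t r h h')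
    hcQ hcL hβ hβ2 hQ hL (by omega) (by omega) (d := d) (by omega) (by omega) (by omega)
  have h4' : altFourArmProbAt t 1 d ≤ 4 / (cQ * cL) * ((N : ℝ) / d) ^ (2 - β) * altFourArmProbAt t r₀ N :=
    (altFourArmProbAt_mono_left t hr₀ (by omega)).trans h4
  have h5 : ((N : ℝ) / d) ^ (2 - β) ≤ 16641 := by
    have hle : (N : ℝ) / d ≤ 129 := by
      rw [div_le_iff₀ hd0]; exact_mod_cast (show N ≤ 129 * d by omega)
    calc ((N : ℝ) / d) ^ (2 - β) ≤ (129 : ℝ) ^ (2 - β) := Real.rpow_le_rpow (by positivity) hle hexp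
      _ ≤ (129 : ℝ) ^ (2 : ℝ) := Real.rpow_le_rpow_of_exponent_le (by norm_num) (by linarith)
      _ = 16641 := by norm_num
  have hqN : 0 ≤ altFourArmProbAt t r₀ N := altFourArmProbAt_nonneg t r₀ N
  calc (triSitePercolation t).real {ω | IsPivotal (landedAltFourArm r₀ N) v ω}
      ≤ altFourArmProbAt t r₀ m * altFourArmProbAt t 1 d := h1
    _ ≤ (P / cE) * (4 / (cQ * cL) * ((N : ℝ) / d) ^ (2 - β) * altFourArmProbAt t r₀ N) :=
        mul_le_mul h23 h4' (altFourArmProbAt_nonneg _ _ _) (by positivity)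
    _ ≤ (P / cE) * (4 / (cQ * cL) * 16641 * altFourArmProbAt t r₀ N) := by
        apply mul_le_mul_of_nonneg_left _ (by positivity)
        apply mul_le_mul_of_nonneg_right _ hqN
        exact mul_le_mul_of_nonneg_left h5 (by positivity)
    _ = 66564 / (cE * cQ * cL) * (altFourArmProbAt t r₀ N * P) := by
        field_simp
        ring

/-- **Deep shells of the boundary layer** (depth `d₀ ≤ d' < N/128`): `boundary_pivotal_three_le_landed`
with `D = N/8`, `m₀ = k - D - 1`, `dℓ = d'`, `d₂ = d' + 1`; host extension for `π̂^alt(r₀, m₀)`, the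
kernel ratio bound for `π̂^alt(1, d')`, and `P_t(B_{T,F}(2d'+1, D-d')) ≤ 48 C_H d'/N`:
`P_t(v pivotal) ≤ (192 C_H/(c_E c_Q c_L)) (N/d')^{2-β} (d'/N) π̂^alt_t(r₀, N) P`. [cite: WernerPCMI2009, Lecture 6, proof of Lemma 6.2 (boundary contributions)] [cite: Nolin2008, §4.6] -/
theorem landed_pivotal_deep (hcQ : 0 < cQ) (hcL : 0 < cL) (hcE : 0 < cE) (hCH : 0 ≤ CH)
    (hβ : 0 < β) (hβ2 : β ≤ 2)
    (hQ : ∀ R S : ℕ, 16 * r₀ < 4 * R → 4 * R < S → S ≤ N →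
      cQ * (altFourArmProbAt t r₀ R * altFourArmProbAt t (4 * R) S) ≤ altFourArmProbAt t r₀ S)
    (hL : ∀ m n : ℕ, rL ≤ m → m ≤ n → n ≤ N → cL * ((m : ℝ) / n) ^ (2 - β) ≤ altFourArmProbAt t m n)
    (hExt : ∀ M : ℕ, N / 64 ≤ M → M ≤ N / 16 - 64 →
      cE * altFourArmProbAt t r₀ M ≤ (triSitePercolation t).real (landedAltFourArm r₀ N))
    (hHP : ∀ m n : ℕ, n₀ ≤ m → m ≤ n → n ≤ N →
      (triSitePercolation t).real (domArmEvent ![true, false] m n upperHalfPlane) ≤ CH * ((m : ℝ) / n))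
    (hr₀ : 1 ≤ r₀) (hN : 128 * (4 * r₀ + 1) + 128 * rL + 20000 ≤ N)
    {v : Site 2} {k d' : ℕ} (hk : triNorm v = k) (hkd : k + d' = N) (hd'1 : 1 ≤ d')
    (hd'n₀ : n₀ ≤ d') (hd'r : 4 * r₀ + 1 ≤ d') (hd'L : rL ≤ d') (hd' : 128 * d' < N) :
    (triSitePercolation t).real {ω | IsPivotal (landedAltFourArm r₀ N) v ω} ≤
      192 * CH / (cE * cQ * cL) * (((N : ℝ) / ((N - k : ℕ) : ℝ)) ^ (2 - β) * (((N - k : ℕ) : ℝ) / N)) *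
        (altFourArmProbAt t r₀ N * (triSitePercolation t).real (landedAltFourArm r₀ N)) := by
  set P : ℝ := (triSitePercolation t).real (landedAltFourArm r₀ N) with hP
  set D : ℕ := N / 8 with hD
  set m₀ : ℕ := k - D - 1 with hm₀
  have hNk : N - k = d' := by omega
  rw [hNk]
  have hN0 : (0 : ℝ) < N := by exact_mod_cast (show 0 < N by omega)
  have hd0 : (0 : ℝ) < d' := by exact_mod_cast (show 0 < d' by omega)
  have hexp : (0 : ℝ) ≤ 2 - β := by linarith
  have h1 := boundary_pivotal_three_le_landed t hr₀ hk hkd (show r₀ ≤ m₀ by omega) hd'1 (le_refl d')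
    (show r₀ + 2 * D ≤ k by omega) (show 4 * D ≤ N by omega) (show m₀ + D + 1 ≤ k by omega)
    (show d' + 1 ≤ d' + 1 by omega) (show d' + 1 + 2 * d' + 1 ≤ D by omega)
  -- inner factor
  have h2 : (triSitePercolation t).real (altFourArm r₀ m₀) ≤ P / cE := by
    have ha : altFourArmProbAt t r₀ m₀ ≤ altFourArmProbAt t r₀ (N / 16 - 64) :=
      altFourArmProbAt_anti t r₀ (by omega) (by omega)
    have hb := hExt (N / 16 - 64) (by omega) le_rfl
    rw [le_div_iff₀ hcE, mul_comm]
    show cE * altFourArmProbAt t r₀ m₀ ≤ P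
    exact (mul_le_mul_of_nonneg_left ha hcE.le).trans hb
  -- local factor
  have h3 := kernel_le_ratio_mul (q := fun r R => altFourArmProbAt t r R)
    (fun r R => altFourArmProbAt_nonneg t r R) (fun r R R' h h' => altFourArmProbAt_anti t r h h')
    hcQ hcL hβ hβ2 hQ hL (by omega) (by omega) (d := d') hd'r hd'L (by omega)
  have h3' : altFourArmProbAt t 1 d' ≤ 4 / (cQ * cL) * ((N : ℝ) / d') ^ (2 - β) * altFourArmProbAt t r₀ N :=
    (altFourArmProbAt_mono_left t hr₀ (by omega)).trans h3
  -- half-plane factor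
  have h4 := hHP (d' + 1 + d') (D - d') (by omega) (by omega) (by omega)
  have h4' : (triSitePercolation t).real (domArmEvent ![true, false] (d' + 1 + d') (D - d') upperHalfPlane) ≤
      48 * CH * ((d' : ℝ) / N) := by
    refine h4.trans ?_
    have hden : (0 : ℝ) < ((D - d' : ℕ) : ℝ) := by exact_mod_cast (show 0 < D - d' by omega)
    have hrat : (((d' + 1 + d' : ℕ) : ℝ)) / ((D - d' : ℕ) : ℝ) ≤ 48 * ((d' : ℝ) / N) := by
      rw [div_le_iff₀ hden, mul_div_assoc', div_mul_eq_mul_div, le_div_iff₀ hN0]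
      have h16 : (N : ℝ) ≤ 16 * ((D - d' : ℕ) : ℝ) := by exact_mod_cast (show N ≤ 16 * (D - d') by omega)
      have h3d : (((d' + 1 + d' : ℕ) : ℝ)) ≤ 3 * d' := by exact_mod_cast (show d' + 1 + d' ≤ 3 * d' by omega)
      have hdd : (0 : ℝ) ≤ d' := hd0.le
      nlinarith
    calc CH * ((((d' + 1 + d' : ℕ) : ℝ)) / ((D - d' : ℕ) : ℝ)) ≤ CH * (48 * ((d' : ℝ) / N)) :=
          mul_le_mul_of_nonneg_left hrat hCH
      _ = 48 * CH * ((d' : ℝ) / N) := by ring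
  have hqN : 0 ≤ altFourArmProbAt t r₀ N := altFourArmProbAt_nonneg t r₀ N
  have hq1 : 0 ≤ altFourArmProbAt t 1 d' := altFourArmProbAt_nonneg t 1 d'
  calc (triSitePercolation t).real {ω | IsPivotal (landedAltFourArm r₀ N) v ω}
      ≤ (triSitePercolation t).real (altFourArm r₀ m₀) * (altFourArmProbAt t 1 d' *
          (triSitePercolation t).real (domArmEvent ![true, false] (d' + 1 + d') (D - d') upperHalfPlane)) := h1
    _ ≤ (P / cE) * ((4 / (cQ * cL) * ((N : ℝ) / d') ^ (2 - β) * altFourArmProbAt t r₀ N) *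
          (48 * CH * ((d' : ℝ) / N))) :=
        mul_le_mul h2 (mul_le_mul h3' h4' measureReal_nonneg (by positivity))
          (mul_nonneg hq1 measureReal_nonneg) (by positivity)
    _ = 192 * CH / (cE * cQ * cL) * (((N : ℝ) / d') ^ (2 - β) * ((d' : ℝ) / N)) *
          (altFourArmProbAt t r₀ N * P) := by
        field_simp
        ring

/-- **Shallowest shells of the boundary layer** (depth `d' < d₀`): `boundary_pivotal_two_le_landed`
with `D = N/8`, `d₂ = d₀`: `P_t(v pivotal) ≤ (32 C_H d₀/(c_E c_L)) · N π̂^alt_t(r₀, N) P`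
(`P_t(B_{T,F}(d₀ + d', D - d')) ≤ 32 C_H d₀/N` and `c_L ≤ N² π̂^alt(r₀, N)`). [cite: WernerPCMI2009, Lecture 6, proof of Lemma 6.2 (boundary contributions)] [cite: Nolin2008, §4.6] -/
theorem landed_pivotal_shallow (hcL : 0 < cL) (hcE : 0 < cE) (hCH : 0 ≤ CH) (hβ : 0 < β)
    (hL : ∀ m n : ℕ, rL ≤ m → m ≤ n → n ≤ N → cL * ((m : ℝ) / n) ^ (2 - β) ≤ altFourArmProbAt t m n)
    (hExt : ∀ M : ℕ, N / 64 ≤ M → M ≤ N / 16 - 64 →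
      cE * altFourArmProbAt t r₀ M ≤ (triSitePercolation t).real (landedAltFourArm r₀ N))
    (hHP : ∀ m n : ℕ, n₀ ≤ m → m ≤ n → n ≤ N →
      (triSitePercolation t).real (domArmEvent ![true, false] m n upperHalfPlane) ≤ CH * ((m : ℝ) / n))
    {d₀ : ℕ} (hr₀ : 1 ≤ r₀) (hrL : rL ≤ r₀) (hd₀ : 1 ≤ d₀) (hd₀n : n₀ ≤ d₀)
    (hN : 64 * r₀ + 64 * d₀ + 20000 ≤ N)
    {v : Site 2} {k d' : ℕ} (hk : triNorm v = k) (hkd : k + d' = N) (hd' : d' < d₀) :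
    (triSitePercolation t).real {ω | IsPivotal (landedAltFourArm r₀ N) v ω} ≤
      32 * CH * (d₀ : ℝ) / (cE * cL) *
        ((N : ℝ) * (altFourArmProbAt t r₀ N * (triSitePercolation t).real (landedAltFourArm r₀ N))) := by
  set P : ℝ := (triSitePercolation t).real (landedAltFourArm r₀ N) with hP
  set D : ℕ := N / 8 with hD
  set m₀ : ℕ := k - D - 1 with hm₀
  have hN0 : (0 : ℝ) < N := by exact_mod_cast (show 0 < N by omega)
  have h1 := boundary_pivotal_two_le_landed t hr₀ hk hkd (show r₀ ≤ m₀ by omega)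
    hd₀ (show r₀ + 2 * D ≤ k by omega) (show 4 * D ≤ N by omega) (show m₀ + D + 1 ≤ k by omega)
    (show d₀ + 2 * d' + 1 ≤ D by omega)
  have h2 : (triSitePercolation t).real (altFourArm r₀ m₀) ≤ P / cE := by
    have ha : altFourArmProbAt t r₀ m₀ ≤ altFourArmProbAt t r₀ (N / 16 - 64) :=
      altFourArmProbAt_anti t r₀ (by omega) (by omega)
    have hb := hExt (N / 16 - 64) (by omega) le_rfl
    rw [le_div_iff₀ hcE, mul_comm]
    show cE * altFourArmProbAt t r₀ m₀ ≤ P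
    exact (mul_le_mul_of_nonneg_left ha hcE.le).trans hb
  have h4 := hHP (d₀ + d') (D - d') (by omega) (by omega) (by omega)
  have h4' : (triSitePercolation t).real (domArmEvent ![true, false] (d₀ + d') (D - d') upperHalfPlane) ≤
      32 * CH * ((d₀ : ℝ) / N) := by
    refine h4.trans ?_
    have hden : (0 : ℝ) < ((D - d' : ℕ) : ℝ) := by exact_mod_cast (show 0 < D - d' by omega)
    have hrat : (((d₀ + d' : ℕ) : ℝ)) / ((D - d' : ℕ) : ℝ) ≤ 32 * ((d₀ : ℝ) / N) := by
      rw [div_le_iff₀ hden, mul_div_assoc', div_mul_eq_mul_div, le_div_iff₀ hN0]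
      have h16 : (N : ℝ) ≤ 16 * ((D - d' : ℕ) : ℝ) := by exact_mod_cast (show N ≤ 16 * (D - d') by omega)
      have h2d : (((d₀ + d' : ℕ) : ℝ)) ≤ 2 * d₀ := by exact_mod_cast (show d₀ + d' ≤ 2 * d₀ by omega)
      have hdd : (0 : ℝ) ≤ d₀ := by positivity
      nlinarith
    calc CH * ((((d₀ + d' : ℕ) : ℝ)) / ((D - d' : ℕ) : ℝ)) ≤ CH * (32 * ((d₀ : ℝ) / N)) :=
          mul_le_mul_of_nonneg_left hrat hCH
      _ = 32 * CH * ((d₀ : ℝ) / N) := by ring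
  have h5 := cL_le_sq_mul_alt hcL hβ hL hr₀ hrL (by omega)
  have h6 : (1 : ℝ) ≤ (N : ℝ) ^ 2 * altFourArmProbAt t r₀ N / cL := by
    rw [le_div_iff₀ hcL, one_mul]; exact h5
  calc (triSitePercolation t).real {ω | IsPivotal (landedAltFourArm r₀ N) v ω}
      ≤ (P / cE) * (32 * CH * ((d₀ : ℝ) / N)) := (h1.trans (mul_le_mul h2 h4' measureReal_nonneg (by positivity)))
    _ ≤ (P / cE) * (32 * CH * ((d₀ : ℝ) / N)) * ((N : ℝ) ^ 2 * altFourArmProbAt t r₀ N / cL) :=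
        le_mul_of_one_le_right (by positivity) h6
    _ = 32 * CH * (d₀ : ℝ) / (cE * cL) * ((N : ℝ) * (altFourArmProbAt t r₀ N * P)) := by
        field_simp

end Regimes

/-! ### The total pivotal sum -/

/-- A pivotal site of the landed event lies in the annulus `{r₀ ≤ |·| ≤ N}` (the event is
determined by it). [folklore] -/
theorem measureReal_isPivotal_landedAlt_eq_zero (t : unitInterval) {r₀ N : ℕ} (hrN : r₀ ≤ N)
    {v : Site 2} (hv : v ∉ triAnnulus r₀ N) :
    (triSitePercolation t).real {ω | IsPivotal (landedAltFourArm r₀ N) v ω} = 0 := by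
  have : {ω : SiteConfig (Site 2) | IsPivotal (landedAltFourArm r₀ N) v ω} = ∅ := by
    ext ω
    simp only [mem_setOf_eq, mem_empty_iff_false, iff_false]
    intro hpiv
    have hdet := determinedBy_landedAltFourArm hrN
    rw [determinedBy_iff] at hdet
    have hvF : v ∉ (↑(triAnnulus r₀ N) : Set (Site 2)) := fun h => hv (Finset.mem_coe.1 h)
    have key : (insert v ω ∈ landedAltFourArm r₀ N ↔ ω \ {v} ∈ landedAltFourArm r₀ N) := by
      apply hdet
      ext z
      simp only [mem_inter_iff, mem_insert_iff, mem_sdiff, mem_singleton_iff]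
      constructor
      · rintro ⟨h1 | h1, h2⟩
        · exact absurd h2 (h1 ▸ hvF)
        · exact ⟨⟨h1, fun h3 => hvF (h3 ▸ h2)⟩, h2⟩
      · rintro ⟨⟨h1, -⟩, h2⟩; exact ⟨Or.inr h1, h2⟩
    rcases hpiv with ⟨h1, h2⟩ | ⟨h1, h2⟩
    · exact h2 (key.1 h1)
    · exact h2 (key.2 h1)
  simp only [this, measureReal_empty]

/-- **The pivotal sum of the landed alternating event** (Werner 2009, Lecture 6, §5:
"`|d/dp π̂_p(n)| ≤ … ≤ c'' π̂_p(n) × [n² π̂_p(n)]`", the last bracket being `≍ d/dp h_p(n)` by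
Lemma 6.2; here at a fixed `t` and `N`, with the kernel, host and half-plane inputs displayed):
`Σ_{v : r₀ ≤ |v| ≤ N} P_t(v pivotal for landedAltFourArm r₀ N) ≤ K · N² π̂^alt_t(r₀, N) · P_t(landedAltFourArm r₀ N)`,
`K = 18 K₀² K_s + 24 (1 + 1/β) (K_i + K_m) + 18 (1 + 1/β) K_d + 18 K_sh` with the constants of
`landed_pivotal_small/inner/mid/deep/shallow` and `K₀ = 8(4r₀+1) + 8r_L + 2r_H + n₀ + 66` (shells
`k < K₀`: small; `K₀ ≤ k ≤ N - N/128`: bulk and middle range, summed with `sum_shell_weight_le`;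
depth in `[K₀, N/128)`: `layer_sum_deep_le`; depth `< K₀`: `layer_sum_shallow_le`). [cite: WernerPCMI2009, Lecture 6, §5 (proof of Lemma 6.3)] [cite: Nolin2008, §6.2, proof of Thm. 27 (arXiv 0711.4948: Thm. 26)] -/
theorem landedPivotalSum_le {t : unitInterval} {N r₀ rL rH n₀ : ℕ} {cQ cL cH cE CH β : ℝ}
    (hcQ : 0 < cQ) (hcL : 0 < cL) (hcH : 0 < cH) (hcE : 0 < cE) (hCH : 0 ≤ CH) (hβ : 0 < β) (hβ1 : β ≤ 1)
    (hQ : ∀ R S : ℕ, 16 * r₀ < 4 * R → 4 * R < S → S ≤ N →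
      cQ * (altFourArmProbAt t r₀ R * altFourArmProbAt t (4 * R) S) ≤ altFourArmProbAt t r₀ S)
    (hL : ∀ m n : ℕ, rL ≤ m → m ≤ n → n ≤ N → cL * ((m : ℝ) / n) ^ (2 - β) ≤ altFourArmProbAt t m n)
    (hHost : ∀ m m' : ℕ, rH ≤ m → m' ≤ 8 * m → 16 * m + 1024 ≤ N →
      cH * (altFourArmProbAt t r₀ m * altFourArmProbAt t m' N) ≤
        (triSitePercolation t).real (landedAltFourArm r₀ N))
    (hExt : ∀ M : ℕ, N / 64 ≤ M → M ≤ N / 16 - 64 →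
      cE * altFourArmProbAt t r₀ M ≤ (triSitePercolation t).real (landedAltFourArm r₀ N))
    (hHP : ∀ m n : ℕ, n₀ ≤ m → m ≤ n → n ≤ N →
      (triSitePercolation t).real (domArmEvent ![true, false] m n upperHalfPlane) ≤ CH * ((m : ℝ) / n))
    (hr₀ : 1 ≤ r₀) (hrL : rL ≤ r₀)
    (hN : 128 * (8 * (4 * r₀ + 1) + 8 * rL + 2 * rH + n₀ + 66) + 20000 ≤ N) :
    ∑ v ∈ triAnnulus r₀ N, (triSitePercolation t).real {ω | IsPivotal (landedAltFourArm r₀ N) v ω} ≤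
      (18 * ((8 * (4 * r₀ + 1) + 8 * rL + 2 * rH + n₀ + 66 : ℕ) : ℝ) ^ 2 *
          (((8 * (4 * r₀ + 1) + 8 * rL + 2 * rH + n₀ + 66 : ℕ) : ℝ) ^ 2 / (cQ * cL ^ 2 * cE * (r₀ : ℝ) ^ 2)) +
        24 * (1 + 1 / β) * (324 / (cH * cQ * cL) + 66564 / (cE * cQ * cL)) +
        18 * (1 + 1 / β) * (192 * CH / (cE * cQ * cL)) +
        18 * (32 * CH * ((8 * (4 * r₀ + 1) + 8 * rL + 2 * rH + n₀ + 66 : ℕ) : ℝ) ^ 2 / (cE * cL))) *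
        ((N : ℝ) ^ 2 * altFourArmProbAt t r₀ N) * (triSitePercolation t).real (landedAltFourArm r₀ N) := by
  classical
  set K₀ : ℕ := 8 * (4 * r₀ + 1) + 8 * rL + 2 * rH + n₀ + 66 with hK₀
  set P : ℝ := (triSitePercolation t).real (landedAltFourArm r₀ N) with hP
  set W : ℝ := altFourArmProbAt t r₀ N * P with hW
  have hW0 : 0 ≤ W := mul_nonneg (altFourArmProbAt_nonneg _ _ _) measureReal_nonneg
  have hN0 : (0 : ℝ) < N := by exact_mod_cast (show 0 < N by omega)
  have hN1 : 1 ≤ N := by omega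
  have hK₀r : r₀ ≤ K₀ := by rw [hK₀]; linarith
  have hNK₀ : 64 * r₀ + 64 * K₀ + 20000 ≤ N := by linarith
  have hβ2 : β ≤ 2 := hβ1.trans one_le_two
  set Ks : ℝ := (K₀ : ℝ) ^ 2 / (cQ * cL ^ 2 * cE * (r₀ : ℝ) ^ 2) with hKs
  set Ki : ℝ := 324 / (cH * cQ * cL) with hKi
  set Km : ℝ := 66564 / (cE * cQ * cL) with hKm
  set Kd : ℝ := 192 * CH / (cE * cQ * cL) with hKd
  set Ksh : ℝ := 32 * CH * (K₀ : ℝ) ^ 2 / (cE * cL) with hKsh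
  have hK00 : (0 : ℝ) < K₀ := by exact_mod_cast (show 0 < K₀ by omega)
  have hr00 : (0 : ℝ) < r₀ := by exact_mod_cast (show 0 < r₀ by omega)
  have hKs0 : 0 ≤ Ks := by rw [hKs]; positivity
  have hKi0 : 0 ≤ Ki := by rw [hKi]; positivity
  have hKm0 : 0 ≤ Km := by rw [hKm]; positivity
  have hKd0 : 0 ≤ Kd := by rw [hKd]; positivity
  have hKsh0 : 0 ≤ Ksh := by rw [hKsh]; positivity
  set f : Site 2 → ℝ := fun v => (triSitePercolation t).real {ω | IsPivotal (landedAltFourArm r₀ N) v ω}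
    with hf
  have hf0 : ∀ v, 0 ≤ f v := fun v => measureReal_nonneg
  set M₁ : ℕ := N - N / 128 with hM₁
  have hK₀M : K₀ ≤ M₁ := by omega
  have hM₁N : M₁ + 1 ≤ N - K₀ + 1 := by omega
  -- pass to the shells of `Λ_N`
  have hshells : ∑ v ∈ triAnnulus r₀ N, f v ≤ ∑ k ∈ Finset.range (N + 1), ∑ v ∈ triSphere k, f v := by
    rw [← sum_triBall_eq_sum_triSphere f N]
    exact Finset.sum_le_sum_of_subset_of_nonneg (fun v hv => by
      rw [mem_triAnnulus] at hv; rw [mem_triBall_iff]; exact hv.2) fun v _ _ => hf0 v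
  have hrange : Finset.range (N + 1) = Finset.range K₀ ∪ Finset.Ico K₀ (M₁ + 1) ∪
      Finset.Ico (M₁ + 1) (N - K₀ + 1) ∪ Finset.Ico (N - K₀ + 1) (N + 1) := by
    ext k; simp only [Finset.mem_union, Finset.mem_range, Finset.mem_Ico]; omega
  -- (1) small shells
  have hsmall : ∑ k ∈ Finset.range K₀, ∑ v ∈ triSphere k, f v ≤ 18 * (K₀ : ℝ) ^ 2 * Ks * ((N : ℝ) ^ 2 * W) := by
    have hsite : ∀ k ∈ Finset.range K₀, ∀ v ∈ triSphere k, f v ≤ Ks * ((N : ℝ) ^ 2 * W) := by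
      intro k hk v hv
      rw [Finset.mem_range] at hk
      rw [mem_triSphere_iff] at hv
      by_cases hr : r₀ ≤ k
      · have h := landed_pivotal_small hcQ hcL hcE hβ hQ hL hExt hr₀ hrL (K₀ := K₀) (by omega)
          (by omega) hv hr hk
        refine h.trans (le_of_eq ?_)
        rw [hW]; ring
      · push Not at hr
        have : f v = 0 := measureReal_isPivotal_landedAlt_eq_zero t (show r₀ ≤ N by omega)
          (by rw [mem_triAnnulus, hv]; omega)
        rw [this]; positivity
    calc ∑ k ∈ Finset.range K₀, ∑ v ∈ triSphere k, f v
        ≤ ∑ k ∈ Finset.range K₀, ((triSphere k).card : ℝ) * (Ks * ((N : ℝ) ^ 2 * W)) := by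
          refine Finset.sum_le_sum fun k hk => ?_
          calc ∑ v ∈ triSphere k, f v ≤ ∑ v ∈ triSphere k, Ks * ((N : ℝ) ^ 2 * W) :=
                Finset.sum_le_sum (hsite k hk)
            _ = _ := by rw [Finset.sum_const, nsmul_eq_mul]
      _ ≤ ∑ k ∈ Finset.range K₀, (18 * (K₀ : ℝ)) * (Ks * ((N : ℝ) ^ 2 * W)) := by
          refine Finset.sum_le_sum fun k hk => mul_le_mul_of_nonneg_right ?_ (by positivity)
          rw [Finset.mem_range] at hk
          have := card_triSphere_le k
          exact_mod_cast (show (triSphere k).card ≤ 18 * K₀ by omega)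
      _ = 18 * (K₀ : ℝ) ^ 2 * Ks * ((N : ℝ) ^ 2 * W) := by
          rw [Finset.sum_const, Finset.card_range, nsmul_eq_mul]; ring
  -- (2) bulk and middle shells
  have hbulk : ∑ k ∈ Finset.Ico K₀ (M₁ + 1), ∑ v ∈ triSphere k, f v ≤
      24 * (1 + 1 / β) * (Ki + Km) * ((N : ℝ) ^ 2 * W) := by
    have hsite : ∀ k ∈ Finset.Ico K₀ (M₁ + 1), ∀ v ∈ triSphere k,
        f v ≤ (Ki + Km) * W * ((N : ℝ) ^ (2 - β) * (max (1 : ℝ) k) ^ (β - 2)) := by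
      intro k hk v hv
      rw [Finset.mem_Ico] at hk
      rw [mem_triSphere_iff] at hv
      have hk0 : (0 : ℝ) < k := by exact_mod_cast (show 0 < k by omega)
      have hmax : max (1 : ℝ) k = k := max_eq_right (by exact_mod_cast (show 1 ≤ k by omega))
      have hratio : ((N : ℝ) / k) ^ (2 - β) = (N : ℝ) ^ (2 - β) * (max (1 : ℝ) k) ^ (β - 2) := by
        rw [hmax]; exact div_rpow_two_sub hN0.le hk0
      have hpow1 : (1 : ℝ) ≤ ((N : ℝ) / k) ^ (2 - β) := by
        apply Real.one_le_rpow _ (by linarith)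
        rw [le_div_iff₀ hk0, one_mul]; exact_mod_cast (show k ≤ N by omega)
      by_cases hin : 14 * k + 1024 ≤ N
      · have h := landed_pivotal_inner hcQ hcL hcH hβ hβ2 hQ hL hHost hr₀ (by omega) (by omega) hv
          (by omega) (by omega) (by omega) (by omega) hin
        refine h.trans ?_
        rw [← hratio, hW]
        calc Ki * ((N : ℝ) / k) ^ (2 - β) * (altFourArmProbAt t r₀ N * P)
            ≤ (Ki + Km) * ((N : ℝ) / k) ^ (2 - β) * (altFourArmProbAt t r₀ N * P) := by
              apply mul_le_mul_of_nonneg_right _ hW0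
              exact mul_le_mul_of_nonneg_right (by linarith) (by positivity)
          _ = _ := by ring
      · push Not at hin
        have h := landed_pivotal_mid hcQ hcL hcE hβ hβ2 hQ hL hExt hr₀ (by omega) hv hin (by omega)
        refine h.trans ?_
        rw [← hratio, hW]
        calc Km * (altFourArmProbAt t r₀ N * P) = Km * 1 * (altFourArmProbAt t r₀ N * P) := by ring
          _ ≤ (Ki + Km) * ((N : ℝ) / k) ^ (2 - β) * (altFourArmProbAt t r₀ N * P) := by
              apply mul_le_mul_of_nonneg_right _ hW0
              exact mul_le_mul (by linarith) hpow1 zero_le_one (by positivity)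
          _ = _ := by ring
    have hM1 : 1 ≤ M₁ := by omega
    calc ∑ k ∈ Finset.Ico K₀ (M₁ + 1), ∑ v ∈ triSphere k, f v
        ≤ ∑ k ∈ Finset.Ico K₀ (M₁ + 1), ((triSphere k).card : ℝ) *
            ((Ki + Km) * W * ((N : ℝ) ^ (2 - β) * (max (1 : ℝ) k) ^ (β - 2))) := by
          refine Finset.sum_le_sum fun k hk => ?_
          calc ∑ v ∈ triSphere k, f v
              ≤ ∑ v ∈ triSphere k, (Ki + Km) * W * ((N : ℝ) ^ (2 - β) * (max (1 : ℝ) k) ^ (β - 2)) :=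
                Finset.sum_le_sum (hsite k hk)
            _ = _ := by rw [Finset.sum_const, nsmul_eq_mul]
      _ ≤ ∑ k ∈ Finset.range (M₁ + 1), ((triSphere k).card : ℝ) *
            ((Ki + Km) * W * ((N : ℝ) ^ (2 - β) * (max (1 : ℝ) k) ^ (β - 2))) := by
          refine Finset.sum_le_sum_of_subset_of_nonneg (fun k hk => ?_) fun k _ _ => by positivity
          rw [Finset.mem_Ico] at hk; rw [Finset.mem_range]; exact hk.2
      _ ≤ ∑ k ∈ Finset.range (M₁ + 1), (12 * (k : ℝ) + 6) *
            ((Ki + Km) * W * ((N : ℝ) ^ (2 - β) * (max (1 : ℝ) k) ^ (β - 2))) := by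
          refine Finset.sum_le_sum fun k _ => mul_le_mul_of_nonneg_right ?_ (by positivity)
          exact_mod_cast card_triSphere_le k
      _ = (Ki + Km) * W * (N : ℝ) ^ (2 - β) *
            ∑ k ∈ Finset.range (M₁ + 1), (12 * (k : ℝ) + 6) * (max (1 : ℝ) k) ^ (β - 2) := by
          rw [Finset.mul_sum]; refine Finset.sum_congr rfl fun k _ => ?_; ring
      _ ≤ (Ki + Km) * W * (N : ℝ) ^ (2 - β) * (24 * (1 + 1 / β) * (M₁ : ℝ) ^ β) :=
          mul_le_mul_of_nonneg_left (sum_shell_weight_le hβ hβ1 hM1) (by positivity)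
      _ ≤ (Ki + Km) * W * (N : ℝ) ^ (2 - β) * (24 * (1 + 1 / β) * (N : ℝ) ^ β) := by
          apply mul_le_mul_of_nonneg_left _ (by positivity)
          apply mul_le_mul_of_nonneg_left _ (by positivity)
          exact Real.rpow_le_rpow (by positivity) (by exact_mod_cast (show M₁ ≤ N by omega)) hβ.le
      _ = 24 * (1 + 1 / β) * (Ki + Km) * (((N : ℝ) ^ (2 - β) * (N : ℝ) ^ β) * W) := by ring
      _ = 24 * (1 + 1 / β) * (Ki + Km) * ((N : ℝ) ^ 2 * W) := by
          rw [← Real.rpow_add hN0, sub_add_cancel, Real.rpow_two]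
  -- (3) deep shells of the layer
  have hdeep : ∑ k ∈ Finset.Ico (M₁ + 1) (N - K₀ + 1), ∑ v ∈ triSphere k, f v ≤
      18 * Kd * (1 + 1 / β) * ((N : ℝ) ^ 2 * W) := by
    refine layer_sum_deep_le hKd0 hW0 hβ hβ1 hN1 (by omega) f fun k hk v hv => ?_
    rw [Finset.mem_Ico] at hk
    rw [mem_triSphere_iff] at hv
    have h := landed_pivotal_deep hcQ hcL hcE hCH hβ hβ2 hQ hL hExt hHP hr₀ (by omega) hv
      (show k + (N - k) = N by omega) (show 1 ≤ N - k by omega) (show n₀ ≤ N - k by omega)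
      (show 4 * r₀ + 1 ≤ N - k by omega) (show rL ≤ N - k by omega) (show 128 * (N - k) < N by omega)
    refine h.trans (le_of_eq ?_)
    rw [hW]
  -- (4) shallow shells of the layer
  have hshallow : ∑ k ∈ Finset.Ico (N - K₀ + 1) (N + 1), ∑ v ∈ triSphere k, f v ≤
      18 * Ksh * ((N : ℝ) ^ 2 * W) := by
    have hB : 0 ≤ 32 * CH * (K₀ : ℝ) / (cE * cL) * ((N : ℝ) * W) := by positivity
    have h := layer_sum_shallow_le (a := N - K₀ + 1) hN1 hB f fun k hk v hv => by
      rw [Finset.mem_Ico] at hk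
      rw [mem_triSphere_iff] at hv
      have h := landed_pivotal_shallow hcL hcE hCH hβ hL hExt hHP hr₀ hrL (show 1 ≤ K₀ by omega)
        (show n₀ ≤ K₀ by omega) hNK₀ hv
        (show k + (N - k) = N by omega) (show N - k < K₀ by omega)
      refine h.trans (le_of_eq ?_)
      rw [hW]
    refine h.trans ?_
    have hcard : ((N + 1 - (N - K₀ + 1) : ℕ) : ℝ) ≤ K₀ := by exact_mod_cast (show N + 1 - (N - K₀ + 1) ≤ K₀ by omega)
    calc ((N + 1 - (N - K₀ + 1) : ℕ) : ℝ) * (18 * N * (32 * CH * (K₀ : ℝ) / (cE * cL) * ((N : ℝ) * W)))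
        ≤ (K₀ : ℝ) * (18 * N * (32 * CH * (K₀ : ℝ) / (cE * cL) * ((N : ℝ) * W))) :=
          mul_le_mul_of_nonneg_right hcard (by positivity)
      _ = 18 * Ksh * ((N : ℝ) ^ 2 * W) := by rw [hKsh]; field_simp
  -- total
  have htotal : ∑ k ∈ Finset.range (N + 1), ∑ v ∈ triSphere k, f v ≤
      (18 * (K₀ : ℝ) ^ 2 * Ks + 24 * (1 + 1 / β) * (Ki + Km) + 18 * (1 + 1 / β) * Kd + 18 * Ksh) *
        ((N : ℝ) ^ 2 * W) := by
    rw [hrange, Finset.sum_union, Finset.sum_union, Finset.sum_union]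
    · calc _ ≤ 18 * (K₀ : ℝ) ^ 2 * Ks * ((N : ℝ) ^ 2 * W) + 24 * (1 + 1 / β) * (Ki + Km) * ((N : ℝ) ^ 2 * W) +
            18 * Kd * (1 + 1 / β) * ((N : ℝ) ^ 2 * W) + 18 * Ksh * ((N : ℝ) ^ 2 * W) :=
            add_le_add (add_le_add (add_le_add hsmall hbulk) hdeep) hshallow
        _ = _ := by ring
    · rw [Finset.disjoint_left]; intro k h1 h2
      rw [Finset.mem_range] at h1; rw [Finset.mem_Ico] at h2; omega
    · rw [Finset.disjoint_left]; intro k h1 h2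
      rw [Finset.mem_union, Finset.mem_range, Finset.mem_Ico] at h1; rw [Finset.mem_Ico] at h2; omega
    · rw [Finset.disjoint_left]; intro k h1 h2
      rw [Finset.mem_union, Finset.mem_union, Finset.mem_range, Finset.mem_Ico, Finset.mem_Ico] at h1
      rw [Finset.mem_Ico] at h2; omega
  calc ∑ v ∈ triAnnulus r₀ N, f v ≤ ∑ k ∈ Finset.range (N + 1), ∑ v ∈ triSphere k, f v := hshells
    _ ≤ _ := htotal
    _ = _ := by rw [hW, hKs, hKi, hKm, hKd, hKsh]; ring

end Literature.Probability.Percolation
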